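/-
Copyright (c) 2026 the pub-hodgecm-mathlib formalisation cell (harness21).  Prover seat hodgecm-mathlib-F0P3b-p01 (g24); E1 keeper ∕ dealer
F0P3a-p03 (g29) (E1 ledger row 24 «HOM INTO A TWO-STEP TARGET», LEAD F0P3a-plan (g16) rule-20 generic brick); 2026-09-03.
-/
import Literature.RepresentationTheory.IntertwiningMapDirectSum    -- ★ `exists_embedding_intertwiningMap_toRepresentation` (the `Hom_G(E, A) ↪ Hom_k(V, X)` bridge), `Subrepresentation.coe_toRepresentation_apply`
import Mathlib.LinearAlgebra.Quotient.Basic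
import HarnessLib

/-!
# Intertwining maps into a two-step target: if `Hom_G(E₁, I ∕ A) = 0` and `Hom_G(E ∕ E₁, I ∕ A) = 0` then every `G`-map `E → I` lands in `A`,
# and `Hom_G(E, A) ≃ₗ Hom_G(E, I)` (Bernstein–Zelevinsky 1976 §2; Casselman 1995 §2, §6)

Topic `RepresentationTheory`; namespace `Literature.RepresentationTheory` (next to ★ `IntertwiningMapDirectSum`, whose §3 bridge it uses).  THEOREMS ONLY
(no definition, no instance, no notation, no named fact); Mathlib `Representation.IntertwiningMap`, `Subrepresentation`, `Representation.quotient`.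

THE SITUATION.  `I : G → GL(X)` with an invariant submodule `A ≤ I` (a `Subrepresentation`), so `I` is a two-step object `0 → A → I → I ∕ A → 0`;
`E : G → GL(V)` with an invariant `E₁ ≤ E`, a two-step source `0 → E₁ → E → E ∕ E₁ → 0`.
* §1 VANISHING ALONG A TWO-STEP SOURCE (any commutative ring `k`): if every `G`-map `E₁ → Q` and every `G`-map `E ∕ E₁ → Q` is zero, so is every
  `G`-map `E → Q` (`intertwiningMap_eq_zero_of_twoStep`: restrict, then descend to the quotient); `Hom_G(E, Q) = 0` from `Hom_G(E₁, Q) = 0` alone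
  when `E₁ = ⊤`-like degenerate cases are not needed.
* §2 RANGE IN THE BOTTOM STEP: if every `G`-map `E → I ∕ A` vanishes then every `G`-map `f : E → I` has `f v ∈ A` for all `v`
  (`forall_apply_mem_of_forall_to_quotient_eq_zero`: compose with `mkQ_A`); with §1, from `Hom_G(E₁, I ∕ A) = 0 ∧ Hom_G(E ∕ E₁, I ∕ A) = 0`
  (`forall_apply_mem_of_twoStep`).
* §3 THE HOM EQUIVALENCE (`k` a field): if every `G`-map `E → I` lands in `A`, post-composition with the inclusion `A ↪ I` is a `k`-LINEAR
  EQUIVALENCE `Hom_G(E, A) ≃ₗ[k] Hom_G(E, I)` (`exists_linearEquiv_intertwiningMap_of_forall_apply_mem`, with its action on underlying linear maps),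
  hence `finrank`∕`rank` equalities; assembled two-step forms `exists_linearEquiv_intertwiningMap_of_twoStep`, `finrank_intertwiningMap_eq_of_twoStep`.
Consumers (cell `pub/hodgecm-mathlib`, crux H413, E1 column, RESIDUE MATRIX v1.1 K2′-π² cell, Hom-level half): `I = i_B(χ)` at a case-(2) point with
socle `A = π²(ξ)` and quotient `πⁿ(ξ)`, `E` a self-extension of `π²`, `E₁ = π²_sub`: `Hom_G(π², πⁿ) = 0` gives both hypotheses, so
`dim Hom_G(E, π²) = dim Hom_G(E, i_B χ)` (`= dim Hom_T(r_B E, χ)` by ★ Frobenius) and ★ HOM-COUNT-SPLIT (`Algebra/Module/ExtensionSplitting`) splits `E`.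
HONEST LABEL: count-neutral generic helper; HC_CM is proved only modulo the printed citations (2 remaining named inputs hLiu418, h413) until rung 0 closes.

## References
* [BernsteinZelevinsky1976] I. N. Bernstein, A. V. Zelevinsky, *Representations of the group GL(n, F) where F is a non-archimedean local field*,
  Russian Math. Surveys 31:3 (1976), §2.1–§2.4 (subrepresentations, quotients, `Hom` between subquotients), Prop. 2.28.
* [Casselman1995] W. Casselman, *Introduction to the theory of admissible representations of p-adic reductive groups* (1995), §2.1 (exactness
  conventions), §6.3–§6.4 (Jordan–Hölder bookkeeping of `Hom` spaces).
* [BourbakiAlgebre1a3] N. Bourbaki, *Algèbre* I, Ch. II §1 no. 3, no. 5 (canonical injection ∕ surjection; maps into a submodule, out of a quotient).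
-/

set_option autoImplicit false

namespace Literature.RepresentationTheory

open Representation Representation.IntertwiningMap

/-! ## §1 Vanishing of `Hom_G(E, Q)` along a two-step source `0 → E₁ → E → E ∕ E₁ → 0` -/

section TwoStepSource

variable {k G V Y : Type*} [CommRing k] [Monoid G] [AddCommGroup V] [Module k V] [AddCommGroup Y] [Module k Y]
  {E : Representation k G V} {Q : Representation k G Y}

/-- **A `G`-map vanishing on an invariant submodule descends to the quotient**: for `ψ : E → Q` with `ψ|_{E₁} = 0` there is a `G`-map
`ψ̄ : E ∕ E₁ → Q` with `ψ̄ [v] = ψ v` (Mathlib `Submodule.liftQ`; `E ∕ E₁` = Mathlib `Representation.quotient`).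
[cite: BourbakiAlgebre1a3, Ch. II §1 no. 5] [cite: BernsteinZelevinsky1976, §2.1] -/
theorem exists_intertwiningMap_quotient_of_forall_mem_eq_zero (E₁ : Subrepresentation E) (ψ : IntertwiningMap E Q)
    (hψ : ∀ v ∈ E₁.toSubmodule, ψ v = 0) :
    ∃ ψq : IntertwiningMap (E.quotient E₁.toSubmodule fun g _ hv => E₁.apply_mem_toSubmodule g hv) Q,
      ∀ v : V, ψq (Submodule.Quotient.mk v) = ψ v := by
  have hker : E₁.toSubmodule ≤ LinearMap.ker ψ.toLinearMap := fun v hv => (LinearMap.mem_ker).2 (hψ v hv)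
  refine ⟨(E₁.toSubmodule.liftQ ψ.toLinearMap hker).intertwiningMap_of_isIntertwiningMap _ _ fun g x => ?_, fun v => rfl⟩
  obtain ⟨v, rfl⟩ := Submodule.Quotient.mk_surjective E₁.toSubmodule x
  rw [Representation.quotient_apply, Submodule.mapQ_apply, Submodule.liftQ_apply, Submodule.liftQ_apply]
  exact IntertwiningMap.isIntertwining _ _ ψ g v

/-- **Restriction of a `G`-map to an invariant submodule** is a `G`-map `E₁ → Q` with the same values. [cite: BernsteinZelevinsky1976, §2.1] -/
theorem exists_intertwiningMap_toRepresentation_restrict (E₁ : Subrepresentation E) (ψ : IntertwiningMap E Q) :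
    ∃ ψ₁ : IntertwiningMap E₁.toRepresentation Q, ∀ v : E₁.toSubmodule, ψ₁ v = ψ (v : V) :=
  ⟨(ψ.toLinearMap ∘ₗ E₁.toSubmodule.subtype).intertwiningMap_of_isIntertwiningMap _ _ fun g v => by
    change ψ (E g (v : V)) = Q g (ψ (v : V))
    exact IntertwiningMap.isIntertwining _ _ ψ g (v : V), fun _ => rfl⟩

/-- **VANISHING ALONG A TWO-STEP SOURCE.**  If `Hom_G(E₁, Q) = 0` and `Hom_G(E ∕ E₁, Q) = 0` then `Hom_G(E, Q) = 0`: a `G`-map `ψ : E → Q`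
restricts to `0` on `E₁`, hence descends to `E ∕ E₁`, where it is `0`. [cite: BernsteinZelevinsky1976, §2.1–§2.4] [cite: Casselman1995, §6.3] -/
theorem intertwiningMap_eq_zero_of_twoStep (E₁ : Subrepresentation E)
    (h₁ : ∀ φ : IntertwiningMap E₁.toRepresentation Q, φ = 0)
    (h₂ : ∀ φ : IntertwiningMap (E.quotient E₁.toSubmodule fun g _ hv => E₁.apply_mem_toSubmodule g hv) Q, φ = 0)
    (ψ : IntertwiningMap E Q) : ψ = 0 := by
  obtain ⟨ψ₁, hψ₁⟩ := exists_intertwiningMap_toRepresentation_restrict E₁ ψ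
  have hvan : ∀ v ∈ E₁.toSubmodule, ψ v = 0 := fun v hv => by
    rw [← hψ₁ ⟨v, hv⟩, h₁ ψ₁]; rfl
  obtain ⟨ψq, hψq⟩ := exists_intertwiningMap_quotient_of_forall_mem_eq_zero E₁ ψ hvan
  refine IntertwiningMap.ext (LinearMap.ext fun v => ?_)
  change ψ v = 0
  rw [← hψq v, h₂ ψq]; rfl

end TwoStepSource

/-! ## §2 Every `G`-map `E → I` lands in the bottom step `A` -/

section RangeInBottom

variable {k G V X : Type*} [CommRing k] [Monoid G] [AddCommGroup V] [Module k V] [AddCommGroup X] [Module k X]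
  {E : Representation k G V} {I : Representation k G X}

/-- **Composition with the quotient map**: `f : E → I` gives a `G`-map `E → I ∕ A`, `v ↦ [f v]`. [cite: BourbakiAlgebre1a3, Ch. II §1 no. 5] -/
theorem exists_intertwiningMap_mkQ_comp (A : Subrepresentation I) (f : IntertwiningMap E I) :
    ∃ fq : IntertwiningMap E (I.quotient A.toSubmodule fun g _ hv => A.apply_mem_toSubmodule g hv),
      ∀ v : V, fq v = Submodule.Quotient.mk (f v) :=
  ⟨(A.toSubmodule.mkQ ∘ₗ f.toLinearMap).intertwiningMap_of_isIntertwiningMap _ _ fun g v => by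
    change Submodule.Quotient.mk (f (E g v)) = (I.quotient A.toSubmodule fun g _ hv => A.apply_mem_toSubmodule g hv) g
      (Submodule.Quotient.mk (f v))
    rw [Representation.quotient_apply, Submodule.mapQ_apply, IntertwiningMap.isIntertwining _ _ f g v], fun _ => rfl⟩

/-- **RANGE IN THE BOTTOM STEP.**  If `Hom_G(E, I ∕ A) = 0` then every `G`-map `f : E → I` takes values in `A` (the composite `E → I → I ∕ A`
vanishes). [cite: BernsteinZelevinsky1976, §2.1–§2.4] [cite: Casselman1995, §6.3] -/
theorem forall_apply_mem_of_forall_to_quotient_eq_zero (A : Subrepresentation I)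
    (h : ∀ φ : IntertwiningMap E (I.quotient A.toSubmodule fun g _ hv => A.apply_mem_toSubmodule g hv), φ = 0)
    (f : IntertwiningMap E I) (v : V) : f v ∈ A.toSubmodule := by
  obtain ⟨fq, hfq⟩ := exists_intertwiningMap_mkQ_comp A f
  rw [← Submodule.Quotient.mk_eq_zero, ← hfq v, h fq]
  rfl

/-- **RANGE IN THE BOTTOM STEP, TWO-STEP SOURCE FORM.**  If `Hom_G(E₁, I ∕ A) = 0` and `Hom_G(E ∕ E₁, I ∕ A) = 0` then every `G`-map `f : E → I`
takes values in `A`. [cite: BernsteinZelevinsky1976, §2.1–§2.4] [cite: Casselman1995, §6.3] -/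
theorem forall_apply_mem_of_twoStep (A : Subrepresentation I) (E₁ : Subrepresentation E)
    (h₁ : ∀ φ : IntertwiningMap E₁.toRepresentation (I.quotient A.toSubmodule fun g _ hv => A.apply_mem_toSubmodule g hv), φ = 0)
    (h₂ : ∀ φ : IntertwiningMap (E.quotient E₁.toSubmodule fun g _ hv => E₁.apply_mem_toSubmodule g hv)
      (I.quotient A.toSubmodule fun g _ hv => A.apply_mem_toSubmodule g hv), φ = 0)
    (f : IntertwiningMap E I) (v : V) : f v ∈ A.toSubmodule :=
  forall_apply_mem_of_forall_to_quotient_eq_zero A (intertwiningMap_eq_zero_of_twoStep E₁ h₁ h₂) f v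

/-- The range form: `range f ≤ A`. [cite: BernsteinZelevinsky1976, §2.1–§2.4] -/
theorem range_le_of_twoStep (A : Subrepresentation I) (E₁ : Subrepresentation E)
    (h₁ : ∀ φ : IntertwiningMap E₁.toRepresentation (I.quotient A.toSubmodule fun g _ hv => A.apply_mem_toSubmodule g hv), φ = 0)
    (h₂ : ∀ φ : IntertwiningMap (E.quotient E₁.toSubmodule fun g _ hv => E₁.apply_mem_toSubmodule g hv)
      (I.quotient A.toSubmodule fun g _ hv => A.apply_mem_toSubmodule g hv), φ = 0)
    (f : IntertwiningMap E I) : LinearMap.range f.toLinearMap ≤ A.toSubmodule := by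
  rintro x ⟨v, rfl⟩
  exact forall_apply_mem_of_twoStep A E₁ h₁ h₂ f v

end RangeInBottom

/-! ## §3 The `k`-linear equivalence `Hom_G(E, A) ≃ₗ Hom_G(E, I)` and the dimension count -/

section HomEquiv

universe u v w w'

variable {k : Type u} [Field k] {G : Type v} [Monoid G]
  {V : Type w} [AddCommGroup V] [Module k V] {X : Type w'} [AddCommGroup X] [Module k X]
  {E : Representation k G V} {I : Representation k G X}

/-- **`Hom_G(E, A) ≃ₗ[k] Hom_G(E, I)` BY POST-COMPOSITION WITH `A ↪ I`** whenever every `G`-map `E → I` takes values in `A`: the map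
`φ ↦ ι_A ∘ φ` is `k`-linear and injective (★ `exists_embedding_intertwiningMap_toRepresentation`), and onto by the hypothesis (corestriction).
Stated as the existence of the linear equivalence together with its action on underlying linear maps. [cite: BourbakiAlgebre1a3, Ch. II §1 no. 3]
[cite: Casselman1995, §6.3] -/
theorem exists_linearEquiv_intertwiningMap_of_forall_apply_mem (A : Subrepresentation I)
    (h : ∀ (f : IntertwiningMap E I) (v : V), f v ∈ A.toSubmodule) :
    ∃ e : IntertwiningMap E A.toRepresentation ≃ₗ[k] IntertwiningMap E I,
      ∀ φ : IntertwiningMap E A.toRepresentation, (e φ).toLinearMap = A.toSubmodule.subtype ∘ₗ φ.toLinearMap := by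
  -- the post-composition map, `k`-linear
  let P : IntertwiningMap E A.toRepresentation →ₗ[k] IntertwiningMap E I :=
    { toFun := fun φ => (A.toSubmodule.subtype ∘ₗ φ.toLinearMap).intertwiningMap_of_isIntertwiningMap _ _ fun g v => by
        change ((φ (E g v) : A.toSubmodule) : X) = I g ((φ v : A.toSubmodule) : X)
        rw [← Subrepresentation.coe_toRepresentation_apply, IntertwiningMap.isIntertwining _ _ φ g v]
      map_add' := fun φ φ' => IntertwiningMap.ext (LinearMap.ext fun v => rfl)
      map_smul' := fun a φ => IntertwiningMap.ext (LinearMap.ext fun v => rfl) }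
  have hP : ∀ φ, (P φ).toLinearMap = A.toSubmodule.subtype ∘ₗ φ.toLinearMap := fun φ => rfl
  have hinj : Function.Injective P := by
    intro φ φ' hφ
    refine IntertwiningMap.ext (LinearMap.ext fun v => Subtype.ext ?_)
    have := congrArg (fun ψ : IntertwiningMap E I => ψ v) hφ
    exact this
  have hsurj : Function.Surjective P := by
    intro f
    refine ⟨(f.toLinearMap.codRestrict A.toSubmodule (h f)).intertwiningMap_of_isIntertwiningMap _ _ fun g v => ?_, ?_⟩
    · exact Subtype.ext (by rw [Subrepresentation.coe_toRepresentation_apply]; exact IntertwiningMap.isIntertwining _ _ f g v)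
    · exact IntertwiningMap.ext (LinearMap.ext fun v => rfl)
  exact ⟨LinearEquiv.ofBijective P ⟨hinj, hsurj⟩, fun φ => hP φ⟩

/-- **`dim_k Hom_G(E, A) = dim_k Hom_G(E, I)`** (finite or not: `Module.finrank` form) whenever every `G`-map `E → I` takes values in `A`.
[cite: Casselman1995, §6.3] [cite: BernsteinZelevinsky1976, §2.1–§2.4] -/
theorem finrank_intertwiningMap_eq_of_forall_apply_mem (A : Subrepresentation I)
    (h : ∀ (f : IntertwiningMap E I) (v : V), f v ∈ A.toSubmodule) :
    Module.finrank k (IntertwiningMap E A.toRepresentation) = Module.finrank k (IntertwiningMap E I) := by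
  obtain ⟨e, -⟩ := exists_linearEquiv_intertwiningMap_of_forall_apply_mem A h
  exact e.finrank_eq

/-- Finite-dimensionality transfers: `Hom_G(E, I)` is finite-dimensional iff `Hom_G(E, A)` is, when every `G`-map `E → I` lands in `A`.
[cite: Casselman1995, §6.3] -/
theorem finiteDimensional_intertwiningMap_iff_of_forall_apply_mem (A : Subrepresentation I)
    (h : ∀ (f : IntertwiningMap E I) (v : V), f v ∈ A.toSubmodule) :
    FiniteDimensional k (IntertwiningMap E A.toRepresentation) ↔ FiniteDimensional k (IntertwiningMap E I) := by
  obtain ⟨e, -⟩ := exists_linearEquiv_intertwiningMap_of_forall_apply_mem A h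
  exact ⟨fun _ => Module.Finite.equiv e, fun _ => Module.Finite.equiv e.symm⟩

/-- **THE TWO-STEP HOM EQUIVALENCE.**  `0 → A → I → I ∕ A → 0` and `0 → E₁ → E → E ∕ E₁ → 0` with `Hom_G(E₁, I ∕ A) = 0` and
`Hom_G(E ∕ E₁, I ∕ A) = 0`: post-composition with `A ↪ I` is a `k`-linear equivalence `Hom_G(E, A) ≃ₗ Hom_G(E, I)`.
[cite: BernsteinZelevinsky1976, §2.1–§2.4] [cite: Casselman1995, §6.3–§6.4] -/
theorem exists_linearEquiv_intertwiningMap_of_twoStep (A : Subrepresentation I) (E₁ : Subrepresentation E)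
    (h₁ : ∀ φ : IntertwiningMap E₁.toRepresentation (I.quotient A.toSubmodule fun g _ hv => A.apply_mem_toSubmodule g hv), φ = 0)
    (h₂ : ∀ φ : IntertwiningMap (E.quotient E₁.toSubmodule fun g _ hv => E₁.apply_mem_toSubmodule g hv)
      (I.quotient A.toSubmodule fun g _ hv => A.apply_mem_toSubmodule g hv), φ = 0) :
    ∃ e : IntertwiningMap E A.toRepresentation ≃ₗ[k] IntertwiningMap E I,
      ∀ φ : IntertwiningMap E A.toRepresentation, (e φ).toLinearMap = A.toSubmodule.subtype ∘ₗ φ.toLinearMap :=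
  exists_linearEquiv_intertwiningMap_of_forall_apply_mem A (forall_apply_mem_of_twoStep A E₁ h₁ h₂)

/-- **THE TWO-STEP DIMENSION COUNT**: `dim_k Hom_G(E, A) = dim_k Hom_G(E, I)` under `Hom_G(E₁, I ∕ A) = 0`, `Hom_G(E ∕ E₁, I ∕ A) = 0` — the
Hom-level half of the K2′ bookkeeping («`Hom(πⁿ, ·) = 0 ⇒ dim Hom(E, π²) = dim Hom(E, i_B χ)`»). [cite: BernsteinZelevinsky1976, Prop. 2.28]
[cite: Casselman1995, §6.3–§6.4] -/
theorem finrank_intertwiningMap_eq_of_twoStep (A : Subrepresentation I) (E₁ : Subrepresentation E)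
    (h₁ : ∀ φ : IntertwiningMap E₁.toRepresentation (I.quotient A.toSubmodule fun g _ hv => A.apply_mem_toSubmodule g hv), φ = 0)
    (h₂ : ∀ φ : IntertwiningMap (E.quotient E₁.toSubmodule fun g _ hv => E₁.apply_mem_toSubmodule g hv)
      (I.quotient A.toSubmodule fun g _ hv => A.apply_mem_toSubmodule g hv), φ = 0) :
    Module.finrank k (IntertwiningMap E A.toRepresentation) = Module.finrank k (IntertwiningMap E I) :=
  finrank_intertwiningMap_eq_of_forall_apply_mem A (forall_apply_mem_of_twoStep A E₁ h₁ h₂)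

end HomEquiv

end Literature.RepresentationTheory
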